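import Literature.NumberTheory.LFunctions.Zhang2022.MainTermFormPSD

/-!
# The main-term form on pure frequencies: `𝔅(e^{−iπjy}) = 8π(j−1)(j−2)(j−3)/j`

Companion to `MainTermFormPSD` (the glued main-term Hermitian form `𝔅` of the Zhang (2022)
repair cell, `mainTermForm`, proved positive semidefinite there). Here `𝔅` is EVALUATED on the
pure frequencies `k_j(y) = e^{−iπjy}`, `j ≥ 1`, directly from the closed formula
`mainTermForm_eq`:

  `𝔅(k_j, k_j) = 8π (j−1)(j−2)(j−3) / j`            (`mainTermForm_afeDir`).

Consequences: the three approximate-functional-equation directions `e^{−iπy}, e^{−2iπy},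
e^{−3iπy}` (STRUCTURE §5 / PROOF-O15 (T4) of the cell) are null vectors of the positive
semidefinite form `𝔅` (`mainTermForm_afeDir_one/two/three`), hence — by Cauchy–Schwarz for a PSD
Hermitian form — lie in its kernel; and `𝔅(k_j) > 0` for every `j ≥ 4`
(`mainTermForm_afeDir_pos`). The values are the lattice weights of PROOF-O15's reading of (T2):
the bulk symbol `8π³ ξ(ξ+1)(ξ+2)(ξ+3)` at `ξ = −j`, divided by `‖k_j′‖²/‖k_j‖²·(1/π²) = π²j²/π²`.

Ingredients: `‖k_j′‖² = π²j²`, `Im⟨k_j′, k_j⟩ = −πj`, `‖k_j‖² = 1`, `∫₀ˣ k_j = (k_j(x) − 1)/c_j`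
with `c_j = −iπj` (`integral_exp_mul_complex`), `Im⟨k_j, S⟩ = −1/(πj)`, `k_j(1) = (−1)^j`, and the
vanishing of both boundary terms. All statements are tagged `[folklore]` (elementary calculus;
the objects are the repair cell's, recorded in `run/shared/lean/pub/pub-zhang/`).
-/

noncomputable section

open MeasureTheory Set intervalIntegral
open scoped Real ComplexConjugate
open Literature.Analysis.Fourier

namespace Literature.NumberTheory.LFunctions.Zhang2022

/-! ### Pure frequencies: `𝔅(e^{−iπjy}, e^{−iπjy}) = 8π(j−1)(j−2)(j−3)/j` -/

/-- The frequency constant `c_j = −iπj` of the direction `e^{−iπjy}`. [folklore] -/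
def afeFreq (j : ℕ) : ℂ := -((j : ℂ) * π * Complex.I)

/-- The pure-frequency profile `k_j(y) = e^{−iπjy}` — for `j = 1,2,3` the three
approximate-functional-equation directions of the repair cell's STRUCTURE §5. [folklore] -/
def afeDir (j : ℕ) (y : ℝ) : ℂ := Complex.exp (afeFreq j * y)

/-- Its derivative `k_j′ = −iπj·k_j`. [folklore] -/
def afeDir' (j : ℕ) (y : ℝ) : ℂ := afeFreq j * afeDir j y

/-- `Re c_j = 0`. [folklore] -/
theorem afeFreq_re (j : ℕ) : (afeFreq j).re = 0 := by simp [afeFreq]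

/-- `Im c_j = −jπ`. [folklore] -/
theorem afeFreq_im (j : ℕ) : (afeFreq j).im = -((j : ℝ) * π) := by simp [afeFreq]

/-- `c_j ≠ 0` for `j ≠ 0`. [folklore] -/
theorem afeFreq_ne_zero {j : ℕ} (hj : j ≠ 0) : afeFreq j ≠ 0 := by
  intro h
  have him := congrArg Complex.im h
  rw [afeFreq_im, Complex.zero_im, neg_eq_zero] at him
  rcases mul_eq_zero.mp him with h1 | h2
  · exact hj (by exact_mod_cast h1)
  · exact Real.pi_ne_zero h2

/-- `conj c_j = −c_j`. [folklore] -/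
theorem conj_afeFreq (j : ℕ) : conj (afeFreq j) = -afeFreq j := by
  apply Complex.ext <;> simp [afeFreq_re, afeFreq_im]

/-- `1/c_j = i/(jπ)`. [folklore] -/
theorem inv_afeFreq {j : ℕ} (hj : j ≠ 0) :
    (afeFreq j)⁻¹ = ((1 / ((j : ℝ) * π) : ℝ) : ℂ) * Complex.I := by
  have hjr : (j : ℝ) ≠ 0 := Nat.cast_ne_zero.mpr hj
  have hπ : π ≠ 0 := Real.pi_ne_zero
  apply inv_eq_of_mul_eq_one_right
  apply Complex.ext <;> (simp [afeFreq, Complex.mul_re, Complex.mul_im]; try field_simp)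

/-- `e^{c_j} = (−1)^j`. [folklore] -/
theorem exp_afeFreq (j : ℕ) : Complex.exp (afeFreq j) = (-1) ^ j := by
  rw [afeFreq, show -((j : ℂ) * π * Complex.I) = (j : ℂ) * (-(π * Complex.I)) by ring,
    Complex.exp_nat_mul, Complex.exp_neg, Complex.exp_pi_mul_I, inv_neg, inv_one]

/-- `‖c_j‖ = jπ`. [folklore] -/
theorem norm_afeFreq (j : ℕ) : ‖afeFreq j‖ = (j : ℝ) * π := by
  rw [afeFreq, norm_neg, norm_mul, norm_mul, Complex.norm_natCast, Complex.norm_real, Complex.norm_I,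
    Real.norm_eq_abs, abs_of_pos Real.pi_pos, mul_one]

/-- `|k_j(y)| = 1`. [folklore] -/
theorem norm_afeDir (j : ℕ) (y : ℝ) : ‖afeDir j y‖ = 1 := by
  rw [afeDir, Complex.norm_exp, Complex.mul_re, afeFreq_re, afeFreq_im, Complex.ofReal_re,
    Complex.ofReal_im]
  simp

/-- `k_j · conj k_j = 1`. [folklore] -/
theorem afeDir_mul_conj (j : ℕ) (y : ℝ) : afeDir j y * conj (afeDir j y) = 1 := by
  rw [Complex.mul_conj', norm_afeDir]; simp

/-- `k_j(0) = 1`. [folklore] -/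
theorem afeDir_zero (j : ℕ) : afeDir j 0 = 1 := by simp [afeDir]

/-- `k_j(1) = (−1)^j`. [folklore] -/
theorem afeDir_one (j : ℕ) : afeDir j 1 = (-1) ^ j := by simp [afeDir, exp_afeFreq]

/-- `k_j` is continuous. [folklore] -/
theorem continuous_afeDir (j : ℕ) : Continuous (afeDir j) := by unfold afeDir; fun_prop

/-- `k_j′ = c_j k_j`. [folklore] -/
theorem hasDerivAt_afeDir (j : ℕ) (y : ℝ) : HasDerivAt (afeDir j) (afeDir' j y) y := by
  have h1 : HasDerivAt (fun y : ℝ => afeFreq j * (y : ℂ)) (afeFreq j) y := by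
    simpa using ((hasDerivAt_id y).ofReal_comp).const_mul (afeFreq j)
  have h2 := (Complex.hasDerivAt_exp _).comp y h1
  refine h2.congr_deriv ?_
  simp only [afeDir', afeDir]
  ring

/-- `k_j ∈ C¹[0,1]`. [folklore] -/
theorem isC1_afeDir (j : ℕ) : IsC1OnUnitInterval (afeDir j) (afeDir' j) := by
  refine ⟨(continuous_afeDir j).continuousOn, ?_, fun y _ => hasDerivAt_afeDir j y⟩
  have : Continuous (afeDir' j) := by
    unfold afeDir'; exact continuous_const.mul (continuous_afeDir j)
  exact this.continuousOn

/-- `∫₀ˣ k_j = (k_j(x) − 1)/c_j`. [folklore] -/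
theorem primitive_afeDir {j : ℕ} (hj : j ≠ 0) (x : ℝ) :
    ∫ t in (0:ℝ)..x, afeDir j t = (afeDir j x - 1) / afeFreq j := by
  simp only [afeDir]
  rw [integral_exp_mul_complex (afeFreq_ne_zero hj)]
  simp

/-- **The main-term form on pure frequencies**: for `j ≥ 1`,
`𝔅(e^{−iπjy}, e^{−iπjy}) = 8π(j−1)(j−2)(j−3)/j`. In particular the three
approximate-functional-equation directions `j = 1, 2, 3` are NULL VECTORS of the positive
semidefinite form `𝔅` (the kernel directions of PROOF-O15 (T4)), and `𝔅 > 0` on every other pure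
frequency; the values are the lattice weights of PROOF-O15's reading of (T2) (bulk symbol
`8π³ξ(ξ+1)(ξ+2)(ξ+3)` at `ξ = −j`, divided by `π²j²`). Direct evaluation of `mainTermForm_eq`:
`‖k_j′‖² = π²j²`, `Im⟨k_j′,k_j⟩ = −πj`, `‖k_j‖² = 1`, `Im⟨k_j,S⟩ = −1/(πj)`, and the two boundary
terms vanish (`Ī(a₀+a₁) ∈ ((−1)^j − 1)((−1)^j + 1)·ℂ = 0`, `a₀ā₁ = (−1)^j ∈ ℝ`). [folklore] -/
theorem mainTermForm_afeDir {j : ℕ} (hj : j ≠ 0) :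
    mainTermForm (afeDir j) (afeDir' j) =
      8 * π * (((j : ℝ) - 1) * ((j : ℝ) - 2) * ((j : ℝ) - 3)) / j := by
  have hc := afeFreq_ne_zero hj
  have hjr : (j : ℝ) ≠ 0 := Nat.cast_ne_zero.mpr hj
  have hπ : π ≠ 0 := Real.pi_ne_zero
  have p1 : ∀ x, ‖afeDir' j x‖ ^ 2 = ((j : ℝ) * π) ^ 2 := by
    intro x; rw [afeDir', norm_mul, norm_afeDir, mul_one, norm_afeFreq]
  have p2 : ∀ x, afeDir' j x * conj (afeDir j x) = afeFreq j := by
    intro x; rw [afeDir', mul_assoc, afeDir_mul_conj, mul_one]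
  have p3 : ∀ x, ‖afeDir j x‖ ^ 2 = 1 := by intro x; rw [norm_afeDir, one_pow]
  have p4 : ∀ x, afeDir j x * conj (∫ t in (0:ℝ)..x, afeDir j t) =
      (afeDir j x - 1) / afeFreq j := by
    intro x
    rw [primitive_afeDir hj, map_div₀, map_sub, map_one, conj_afeFreq]
    have h1 := afeDir_mul_conj j x
    field_simp
    linear_combination (-1 : ℂ) * h1
  have T1 : ∫ x in (0:ℝ)..1, ‖afeDir' j x‖ ^ 2 = ((j : ℝ) * π) ^ 2 := by
    simp only [p1, intervalIntegral.integral_const, sub_zero, smul_eq_mul, one_mul]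
  have T2 : ∫ x in (0:ℝ)..1, afeDir' j x * conj (afeDir j x) = afeFreq j := by
    simp only [p2, intervalIntegral.integral_const, sub_zero, one_smul]
  have T3 : ∫ x in (0:ℝ)..1, ‖afeDir j x‖ ^ 2 = 1 := by
    simp only [p3, intervalIntegral.integral_const, sub_zero, smul_eq_mul, mul_one]
  have T4 : ∫ x in (0:ℝ)..1, afeDir j x * conj (∫ t in (0:ℝ)..x, afeDir j t) =
      (((-1 : ℂ) ^ j - 1) / afeFreq j - 1) / afeFreq j := by
    simp only [p4]
    rw [intervalIntegral.integral_div,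
      intervalIntegral.integral_sub ((continuous_afeDir j).intervalIntegrable 0 1)
        intervalIntegrable_const,
      primitive_afeDir hj 1, afeDir_one, intervalIntegral.integral_const]
    simp
  rw [mainTermForm_eq, T1, T2, T3, T4, primitive_afeDir hj 1, afeDir_zero, afeDir_one]
  rcases Nat.even_or_odd j with he | ho
  · rw [he.neg_one_pow]
    simp only [div_eq_mul_inv, inv_afeFreq hj, map_one, map_zero, sub_self, zero_mul, mul_zero,
      zero_sub, Complex.mul_re, Complex.neg_re, Complex.mul_im, Complex.neg_im, Complex.ofReal_re,
      Complex.ofReal_im, Complex.I_re, Complex.I_im, Complex.one_re, Complex.one_im,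
      Complex.zero_re, afeFreq_im]
    field_simp
    ring
  · rw [ho.neg_one_pow]
    simp only [div_eq_mul_inv, inv_afeFreq hj, map_mul, map_sub, map_one, map_neg,
      Complex.conj_ofReal, Complex.conj_I,
      Complex.add_re, Complex.sub_re, Complex.mul_re, Complex.neg_re, Complex.add_im,
      Complex.sub_im, Complex.mul_im, Complex.neg_im, Complex.ofReal_re, Complex.ofReal_im,
      Complex.I_re, Complex.I_im, Complex.one_re, Complex.one_im, afeFreq_im]
    field_simp
    ring

/-- The three approximate-functional-equation directions are null vectors of `𝔅`:
`𝔅(e^{−iπy}) = 0`. [folklore] -/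
theorem mainTermForm_afeDir_one : mainTermForm (afeDir 1) (afeDir' 1) = 0 := by
  rw [mainTermForm_afeDir one_ne_zero]; norm_num

/-- `𝔅(e^{−2iπy}) = 0`. [folklore] -/
theorem mainTermForm_afeDir_two : mainTermForm (afeDir 2) (afeDir' 2) = 0 := by
  rw [mainTermForm_afeDir two_ne_zero]; norm_num

/-- `𝔅(e^{−3iπy}) = 0`. [folklore] -/
theorem mainTermForm_afeDir_three : mainTermForm (afeDir 3) (afeDir' 3) = 0 := by
  rw [mainTermForm_afeDir (by norm_num : (3:ℕ) ≠ 0)]; norm_num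

/-- `𝔅 > 0` on every pure frequency `e^{−iπjy}` with `j ≥ 4`. [folklore] -/
theorem mainTermForm_afeDir_pos {j : ℕ} (hj : 4 ≤ j) : 0 < mainTermForm (afeDir j) (afeDir' j) := by
  rw [mainTermForm_afeDir (by omega : j ≠ 0)]
  have hj' : (4 : ℝ) ≤ j := by exact_mod_cast hj
  have hjpos : (0 : ℝ) < j := by linarith
  apply div_pos _ hjpos
  have h1 : (0:ℝ) < (j : ℝ) - 1 := by linarith
  have h2 : (0:ℝ) < (j : ℝ) - 2 := by linarith
  have h3 : (0:ℝ) < (j : ℝ) - 3 := by linarith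
  positivity

end Literature.NumberTheory.LFunctions.Zhang2022

end
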